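import Summits.BirchSwinnertonDyer.Rank1Residual.X11b.CongruenceLimitOneSided
import Summits.BirchSwinnertonDyer.Rank1Residual.X11b.FittingOfNoFiniteSubmodule
import Summits.BirchSwinnertonDyer.Rank1Residual.X11b.AnticyclotomicModuleFinite
import Summits.BirchSwinnertonDyer.Rank1Residual.X2.HidaLimitCongruenceAlgebra
import Mathlib.RingTheory.Flat.FaithfullyFlat.Algebra
import HarnessLib

/-!
# Route `ErratumRoadFive`, crux `IMCDivAtErratumDataAll` (item stmt-BirchSwinnertonDyer-19270): the
# one-sided congruence limit WITH VARYING COEFFICIENT RINGS — [Ski16, §3.1]'s "replacing `L` by a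
# finite extension if necessary" as a kernel theorem (faithfully flat descent of each congruence
# step), and its instance ON THE TREE OBJECT `X_ac^Σ(E[p^∞])`

Cell `bsd-stepL` (run/shared/lean/pub/bsd-stepL/), PART 1b ACCEL seat `bsd-stepL-imc24c` (prover, row (3));
`--supports stmt-BirchSwinnertonDyer-19270 --as helper`; companion of
`Theorems/ErratumRoadFiveIMCDivOneSidedCongruenceDefs.lean` (the glue to the crux; its docstring
carries the `TODO(general form)` this file discharges). HONEST FRAMING: THEOREMS ONLY (pure
commutative algebra + one instance on the constructed module); no definition, no named fact, no
`sorry`; nothing is asserted about any curve; the item is NOT closed by this; BSD is proved for no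
pair; X11b stays CONSTRUCTION-SHAPED; no label or count moves.

## Why

Every congruence file of the tree (`CongruenceLimit.*`, `X2.HidaLimitAlgebra.*`,
`AcSelmer.XAc.isTorsion_and_charIdeal_eq_of_congruences_printed`, and the glue file above) reads the
members `g_m` with coefficients in ONE ring: `N_m = X^Σ_ac(A_{g_m})` a `Λ`-module, `L^Σ_p(g_m) ∈ R₀⟦T⟧`.
In print the `m`-th member has its own coefficient ring: the Hecke field of `g_m` generates a finite,
possibly RAMIFIED, extension `𝒪_m/ℤ_p`; (b) reads `T_{g_m}/p^m ≃ (T ⊗ 𝒪_m)/p^m`, Lemma 2.1 and the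
member inclusion live over `Λ_{𝒪_m} = 𝒪_m⟦T⟧` and `Λ_{𝒪_m}^{ur} = 𝒪_m^{ur}⟦T⟧`, and the conclusion
for `f` is DESCENDED to `Λ^{ur} = R₀⟦T⟧` — Skinner: "replacing `L` by a finite extension if
necessary we may assume …" (Pacific J. Math. 283 (2016) §2.6, §3.1), legitimate because each step
`(Fitt(X_f), p^m)Λ_{𝒪_m}^{ur} = (L_f, p^m)Λ_{𝒪_m}^{ur}` CONTRACTS to `R₀⟦T⟧` along the faithfully flat
(finite free) extension `R₀⟦T⟧ → 𝒪_m^{ur}⟦T⟧`. This file proves that bookkeeping once and for all: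

* §1 **`CongruenceDescent.map_le_span_of_oneSided_congruences_descent`** — `X2.HidaLimitAlgebra.
  map_le_span_of_oneSided_congruences` (two rings `φ : R → S`, Krull in `S`) with, for EACH `m`, its
  own coefficient square `R → R'_m →(φ'_m) S'_m ← S`, `S'_m` FAITHFULLY FLAT over `S`: members `N_m`
  are `R'_m`-modules, the congruence isomorphism is `(R'_m ⊗_R M)/I^m ≅ N_m/I^m` over `R'_m`, the
  member inclusion `Fitt_{R'_m}(N_m)·S'_m ⊆ (L_m)` and the congruence `(L_m) + I^m S'_m = (L) + I^m S'_m`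
  live in `S'_m`; conclusion `J·S ⊆ (L)` in `S` for every `J ⊆ Fitt_R(M)`. Ingredients: Fitting ideals
  commute with base change (Stacks 07ZA (3), tree `Module.fittingIdeal_baseChange`), "basic properties
  of Fitting ideals" modulo `I^m` (tree `CongruenceLimit.fittingIdeal_sup_eq_of_quotEquiv`), the
  contraction `(𝔞 S') ∩ S = 𝔞` for faithfully flat `S → S'` (Mathlib
  `Ideal.comap_map_eq_self_of_faithfullyFlat`), Krull (tree `CongruenceLimit.iInf_sup_pow_eq_self`).
* §2 **`AcSelmer.XAc.charIdeal_map_toUnr_le_span_of_oneSided_congruences_descent`** — §1 ON THE TREE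
  OBJECT `X^Σ = AcSelmer.XAc E p κ 𝔭 Σ γ` (`R = Λ = ℤ_p⟦T⟧`, `S = R₀⟦T⟧ = UnrSeries p`, `φ = map toUnr`,
  `I = (p)`): with `X^Σ` torsion and without nonzero finite submodule, per-`m` coefficient squares
  `Λ → R'_m → S'_m ← R₀⟦T⟧` (`R'_m = 𝒪_m⟦T⟧`, `S'_m = 𝒪_m^{ur}⟦T⟧`), members over `R'_m` congruent to
  `R'_m ⊗_Λ X^Σ` modulo `p^m`, printed one-sided member inclusions and (c) in `S'_m`:
  **`Ch_Λ(X^Σ)·R₀⟦T⟧ ⊆ (L^Σ)`** — the input `hdiv` of the glue file's §2 ∕ §3, now with honest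
  coefficients. With `R'_m = Λ`, `S'_m = R₀⟦T⟧` it is that file's §1.

Dictionary / what is INPUT: as in the glue file (torsion of `X^Σ` [CTL], Lemma 2.2, the members with
(b)+Lemma 2.1, (2.5)_m [FW21 4.41 at `p ∥ N`, PREPRINT], (c) [Cas20 2.11]); faithful flatness of
`R₀⟦T⟧ → 𝒪_m^{ur}⟦T⟧` is the user's (finite free: `𝒪_m^{ur}` is finite free over the DVR `R₀`).

References: [Skinner2016PacificMC] §2.6, §3.1 (p. 192); [Castella2018Erratum] (a)–(c), Lemmas 2.1–2.2,
proof of Thm. 1.1 (p. 4); [StacksProject] 07ZA (3), 05GI, 00HP (faithfully flat ring maps);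
[Castella2018] Def. 2.2, §3 (arXiv:1704.06608 pp. 5, 9).
-/

set_option autoImplicit false

noncomputable section

open scoped Classical TensorProduct

open PowerSeries Literature.NumberTheory.EllipticCurves Literature.NumberTheory.EllipticCurves.Module
  Literature.RingTheory.FittingIdeal NumberField IsDedekindDomain Field
open Summit.BirchSwinnertonDyer.Rank1Residual.X11b.AcSelmer Summit.BirchSwinnertonDyer.Rank1Residual.X11b.Halves
  Summit.BirchSwinnertonDyer.Rank1Residual.X2

namespace Summit.BirchSwinnertonDyer.Rank1Residual.X11b

/-! ### §1 The one-sided congruence limit across `φ : R → S` with per-member coefficient rings -/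

namespace CongruenceDescent

universe u v w

variable {R : Type*} [CommRing R] {S : Type u} [CommRing S] (φ : R →+* S) (I : Ideal R)
  {M : Type*} [AddCommGroup M] [Module R M] [Module.Finite R M]

/-- **One congruence step with its own coefficients, contracted to `S`.** Data: a commutative square
`R → R' →(φ') S' ← S` (`φ' ∘ (R → R') = (S → S') ∘ φ`) with `S'` FAITHFULLY FLAT over `S`, a finite
`R'`-module `N` (`X^Σ_ac(A_{g_m})` over `Λ_{𝒪_m}`), an `R'`-isomorphism `(R' ⊗_R M)/I^m ≅ N/I^m`
[(b) + Lemma 2.1 over `𝒪_m`], the one-sided member inclusion `Fitt_{R'}(N)·S' ⊆ (L_m)` [(2.5)_m] and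
`(L_m) + I^m S' = (L·1_{S'}) + I^m S'` [(c)] in `S'`. Then, IN `S`: `Fitt_R(M)·S + I^m S ⊆ (L) + I^m S`.
Proof: `Fitt_{R'}(R' ⊗ M) = Fitt_R(M)·R'` (Stacks 07ZA (3)); Fitting ideals modulo `I^m` along the
isomorphism; push to `S'`; contract to `S` by `(𝔞S') ∩ S = 𝔞` (faithful flatness).
[cite: Skinner2016PacificMC, §2.6 and §3.1 (p. 192) ("replacing `L` by a finite extension")]
[cite: StacksProject, Tag 07ZA (3)] -/
theorem map_fittingIdeal_sup_le_of_congruence_descent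
    (R' : Type v) [CommRing R'] [Algebra R R'] (S' : Type w) [CommRing S'] [Algebra S S']
    [Module.FaithfullyFlat S S'] (φ' : R' →+* S')
    (hφ' : φ'.comp (algebraMap R R') = (algebraMap S S').comp φ)
    (N : Type*) [AddCommGroup N] [Module R' N] [Module.Finite R' N] {L : S} {Lm : S'} {m : ℕ}
    (e : ((R' ⊗[R] M) ⧸ ((I.map (algebraMap R R')) ^ m • (⊤ : Submodule R' (R' ⊗[R] M)))) ≃ₗ[R']
      (N ⧸ ((I.map (algebraMap R R')) ^ m • (⊤ : Submodule R' N))))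
    (hF : (Module.fittingIdeal R' N 0).map φ' ≤ Ideal.span {Lm})
    (hc : Ideal.span {Lm} ⊔ ((I.map φ).map (algebraMap S S')) ^ m =
      Ideal.span {algebraMap S S' L} ⊔ ((I.map φ).map (algebraMap S S')) ^ m) :
    (Module.fittingIdeal R M 0).map φ ⊔ (I.map φ) ^ m ≤ Ideal.span {L} ⊔ (I.map φ) ^ m := by
  set ψ : S →+* S' := algebraMap S S' with hψ
  -- the two composite maps `R → S'` agree
  have hcomp : ψ.comp φ = φ'.comp (algebraMap R R') := by rw [hψ, hφ']
  -- images in `S'` of the three ideals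
  have hA : ((Module.fittingIdeal R M 0).map φ).map ψ =
      (Module.fittingIdeal R' (R' ⊗[R] M) 0).map φ' := by
    rw [Ideal.map_map, hcomp, ← Ideal.map_map, Module.fittingIdeal_baseChange]
  have hB : ((I.map φ) ^ m).map ψ = ((I.map (algebraMap R R')) ^ m).map φ' := by
    rw [Ideal.map_pow, Ideal.map_pow, Ideal.map_map, Ideal.map_map, hcomp]
  have hB' : ((I.map φ).map ψ) ^ m = ((I.map (algebraMap R R')) ^ m).map φ' := by
    rw [← Ideal.map_pow, hB]
  have hC : (Ideal.span {L}).map ψ = Ideal.span {ψ L} := by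
    rw [Ideal.map_span, Set.image_singleton]
  -- the congruence step over `R'`, pushed to `S'`
  have hstep : (Module.fittingIdeal R' (R' ⊗[R] M) 0).map φ' ⊔
      ((I.map (algebraMap R R')) ^ m).map φ' ≤
        Ideal.span {Lm} ⊔ ((I.map (algebraMap R R')) ^ m).map φ' := by
    have h1 := congrArg (Ideal.map φ')
      (CongruenceLimit.fittingIdeal_sup_eq_of_quotEquiv ((I.map (algebraMap R R')) ^ m) e 0)
    simp only [Ideal.map_sup] at h1
    rw [h1]
    exact sup_le_sup_right hF _
  -- hence the inclusion of the images in `S'`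
  have himg : ((Module.fittingIdeal R M 0).map φ ⊔ (I.map φ) ^ m).map ψ ≤
      (Ideal.span {L} ⊔ (I.map φ) ^ m).map ψ := by
    rw [Ideal.map_sup, Ideal.map_sup, hA, hB, hC]
    refine hstep.trans ?_
    rw [← hB', hc, hB']
  -- contract to `S` (faithful flatness)
  have h := Ideal.comap_mono (f := ψ) himg
  rwa [hψ, Ideal.comap_map_eq_self_of_faithfullyFlat,
    Ideal.comap_map_eq_self_of_faithfullyFlat] at h

/-- **The one-sided congruence limit with per-member coefficient rings** — [Ski16, §3.1 (p. 192)]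
∕ erratum p. 4 read one-sidedly, "replacing `L` by a finite extension" made explicit. `S`
Noetherian with `φ(I) ⊆ Jac(S)`; `J ⊆ Fitt_R(M)`; for every `m ≥ 1` a coefficient square
`R → R'_m →(φ'_m) S'_m ← S` with `S'_m` faithfully flat over `S`, a finite `R'_m`-module `N_m`, an
`R'_m`-isomorphism `(R'_m ⊗_R M)/I^m ≅ N_m/I^m`, `Fitt_{R'_m}(N_m)·S'_m ⊆ (L_m)` and
`(L_m) + I^m S'_m = (L) + I^m S'_m` in `S'_m`. Then `J·S ⊆ ⋂_m ((L) + I^m S) = (L)` (Krull). No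
torsion-ness or finite-submodule hypothesis on the members; no `L ≠ 0`. With `R'_m = R`, `S'_m = S`
this is `X2.HidaLimitAlgebra.map_le_span_of_oneSided_congruences`.
[cite: Skinner2016PacificMC, §3.1 (p. 192)] [cite: Castella2018Erratum, proof of Thm. 1.1 (p. 4)]
[cite: StacksProject, Tag 05GI (Krull's intersection theorem)] -/
theorem map_le_span_of_oneSided_congruences_descent [IsNoetherianRing S]
    (hI : I.map φ ≤ (⊥ : Ideal S).jacobson) {J : Ideal R} (hJ : J ≤ Module.fittingIdeal R M 0)
    (L : S) (R' : ℕ → Type v) [∀ m, CommRing (R' m)] [∀ m, Algebra R (R' m)]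
    (S' : ℕ → Type w) [∀ m, CommRing (S' m)] [∀ m, Algebra S (S' m)]
    [∀ m, Module.FaithfullyFlat S (S' m)] (φ' : ∀ m, R' m →+* S' m)
    (hφ' : ∀ m, (φ' m).comp (algebraMap R (R' m)) = (algebraMap S (S' m)).comp φ)
    (N : ℕ → Type*) [∀ m, AddCommGroup (N m)] [∀ m, Module (R' m) (N m)]
    [∀ m, Module.Finite (R' m) (N m)] (Lm : ∀ m, S' m)
    (e : ∀ m : ℕ, 1 ≤ m →
      (((R' m ⊗[R] M) ⧸ ((I.map (algebraMap R (R' m))) ^ m •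
          (⊤ : Submodule (R' m) (R' m ⊗[R] M)))) ≃ₗ[R' m]
        (N m ⧸ ((I.map (algebraMap R (R' m))) ^ m • (⊤ : Submodule (R' m) (N m))))))
    (hF : ∀ m : ℕ, 1 ≤ m → (Module.fittingIdeal (R' m) (N m) 0).map (φ' m) ≤ Ideal.span {Lm m})
    (hc : ∀ m : ℕ, 1 ≤ m →
      Ideal.span {Lm m} ⊔ ((I.map φ).map (algebraMap S (S' m))) ^ m =
        Ideal.span {algebraMap S (S' m) L} ⊔ ((I.map φ).map (algebraMap S (S' m))) ^ m) :
    J.map φ ≤ Ideal.span {L} := by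
  refine (Ideal.map_mono hJ).trans ?_
  rw [← CongruenceLimit.iInf_sup_pow_eq_self (I.map φ) (Ideal.span {L}) hI]
  refine le_iInf fun m ↦ ?_
  rcases Nat.eq_zero_or_pos m with rfl | hm
  · rw [pow_zero, Ideal.one_eq_top, sup_top_eq]; exact le_top
  · exact le_sup_left.trans (map_fittingIdeal_sup_le_of_congruence_descent φ I (R' m) (S' m) (φ' m)
      (hφ' m) (N m) (e m hm) (hF m hm) (hc m hm))

/-- **The member input from the PRINTED shape of (2.5)_m with its own coefficients**: if the member
module `N` over `R'` (`Λ_{𝒪_m}`, a Noetherian UFD) is torsion with `Ch_{R'}(N)·S' ⊆ (L')` along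
`φ' : R' → S'`, then `Fitt_{R'}(N)·S' ⊆ (L')` (`Fitt₀ ⊆ Ch`); if it is not torsion, `Fitt_{R'}(N) = 0`
and the input is vacuous. So the hypothesis `hF` of the limit theorems is implied by "`N_m` torsion →
`Ch(N_m)·S'_m ⊆ (L_m)`", the shape in which a main-conjecture divisibility is printed.
[cite: FouquetWan2021, Thm. 4.41 (shape of the conclusion)] [cite: StacksProject, Tag 07ZA] -/
theorem map_fittingIdeal_le_of_printed_charIdeal_le {R' : Type v} [CommRing R'] [IsNoetherianRing R']
    [IsDomain R'] [UniqueFactorizationMonoid R'] {S' : Type w} [CommRing S'] (φ' : R' →+* S')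
    {N : Type} [AddCommGroup N] [Module R' N] [Module.Finite R' N] {L' : S'}
    (hCh : Module.IsTorsion R' N → (Module.charIdeal R' N).map φ' ≤ Ideal.span {L'}) :
    (Module.fittingIdeal R' N 0).map φ' ≤ Ideal.span {L'} := by
  by_cases hNt : Module.IsTorsion R' N
  · exact HidaLimitAlgebra.map_fittingIdeal_le_of_map_charIdeal_le φ' hNt (hCh hNt)
  · have h0 : Module.fittingIdeal R' N 0 = ⊥ :=
      le_bot_iff.mp (Module.fittingIdeal_zero_le_annihilator.trans
        (Module.annihilator_eq_bot_of_not_isTorsion hNt).le)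
    rw [h0, Ideal.map_bot]
    exact bot_le

end CongruenceDescent

/-! ### §2 On the tree object `X_ac^Σ(E[p^∞])`: `Λ → R₀⟦T⟧` with per-member coefficients -/

section XAc

variable {K : Type} [Field K] [NumberField K] (E : WeierstrassCurve K) [E.IsElliptic]
  (p : ℕ) [Fact p.Prime] (κ : ZpExtension K p) (𝔭 : HeightOneSpectrum (𝓞 K))
  {S : Set (HeightOneSpectrum (𝓞 K))} (γ : Field.absoluteGaloisGroup K) [Fact (κ.IsTopGenerator γ)]

universe v w

/-- **Erratum p. 4 ∕ [Ski16, p. 192] read ONE-SIDEDLY ON `X^Σ = X_ac^Σ(E[p^∞])`, members with their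
OWN coefficient rings.** `X^Σ` finitely generated (`Σ` finite), `Λ`-torsion [CTL] and without nonzero
finite-length submodule [erratum Lemma 2.2]; for each `m ≥ 1` a coefficient square `Λ → R'_m →(φ'_m)
S'_m ← R₀⟦T⟧` (`R'_m = Λ_{𝒪_m}`, `S'_m = Λ_{𝒪_m}^{ur}`; `S'_m` faithfully flat over `R₀⟦T⟧` — finite
free in the application), a finite `R'_m`-module `N_m` (`X^Σ_ac(A_{g_m})`) with an `R'_m`-isomorphism
`(R'_m ⊗_Λ X^Σ)/p^m ≅ N_m/p^m` [(b) `T_{g_m}/p^m ≃ (T ⊗ 𝒪_m)/p^m` + Lemma 2.1, dualised], the member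
inclusion `Fitt_{R'_m}(N_m)·S'_m ⊆ (L_m)` [⟸ the PRINTED (2.5)_m `Ch ⊆ (L_m)` when `N_m` is torsion,
`Fitt₀ ⊆ Ch`] and `(L_m) + (p^m) = (L^Σ) + (p^m)` in `S'_m` [(c), Cas20 Thm. 2.11]. THEN
`Ch_Λ(X^Σ)·R₀⟦T⟧ ⊆ (L^Σ)`. Pure algebra on the constructed module (§1 + `Fitt_Λ = Ch_Λ` on `X^Σ`);
CONDITIONAL on the displayed inputs. [cite: Castella2018Erratum, Lemmas 2.1–2.2 and proof of Thm. 1.1 (p. 4), read one-sidedly]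
[cite: Skinner2016PacificMC, §2.6, §3.1 (p. 192)] -/
theorem AcSelmer.XAc.charIdeal_map_toUnr_le_span_of_oneSided_congruences_descent (hS : S.Finite)
    (hT : Module.IsTorsion (IwasawaAlgebra p) (XAc E p κ 𝔭 S γ))
    (hnf : ∀ N' : Submodule (IwasawaAlgebra p) (XAc E p κ 𝔭 S γ),
      Module.length (IwasawaAlgebra p) N' ≠ ⊤ → N' = ⊥)
    (LS : UnrSeries p) (R' : ℕ → Type v) [∀ m, CommRing (R' m)]
    [∀ m, Algebra (IwasawaAlgebra p) (R' m)]
    (S' : ℕ → Type w) [∀ m, CommRing (S' m)] [∀ m, Algebra (UnrSeries p) (S' m)]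
    [∀ m, Module.FaithfullyFlat (UnrSeries p) (S' m)] (φ' : ∀ m, R' m →+* S' m)
    (hφ' : ∀ m, (φ' m).comp (algebraMap (IwasawaAlgebra p) (R' m)) =
      (algebraMap (UnrSeries p) (S' m)).comp (PowerSeries.map (toUnr p)))
    (N : ℕ → Type) [∀ m, AddCommGroup (N m)] [∀ m, Module (R' m) (N m)]
    [∀ m, Module.Finite (R' m) (N m)] (Lm : ∀ m, S' m)
    (e : ∀ m : ℕ, 1 ≤ m →
      (((R' m ⊗[IwasawaAlgebra p] XAc E p κ 𝔭 S γ) ⧸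
          (((Ideal.span {(PowerSeries.C (p : ℤ_[p]) : IwasawaAlgebra p)}).map
              (algebraMap (IwasawaAlgebra p) (R' m))) ^ m •
            (⊤ : Submodule (R' m) (R' m ⊗[IwasawaAlgebra p] XAc E p κ 𝔭 S γ)))) ≃ₗ[R' m]
        (N m ⧸ (((Ideal.span {(PowerSeries.C (p : ℤ_[p]) : IwasawaAlgebra p)}).map
            (algebraMap (IwasawaAlgebra p) (R' m))) ^ m • (⊤ : Submodule (R' m) (N m))))))
    (hF : ∀ m : ℕ, 1 ≤ m → (Module.fittingIdeal (R' m) (N m) 0).map (φ' m) ≤ Ideal.span {Lm m})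
    (hc : ∀ m : ℕ, 1 ≤ m →
      Ideal.span {Lm m} ⊔
          (((Ideal.span {(PowerSeries.C (p : ℤ_[p]) : IwasawaAlgebra p)}).map
              (PowerSeries.map (toUnr p))).map (algebraMap (UnrSeries p) (S' m))) ^ m =
        Ideal.span {algebraMap (UnrSeries p) (S' m) LS} ⊔
          (((Ideal.span {(PowerSeries.C (p : ℤ_[p]) : IwasawaAlgebra p)}).map
              (PowerSeries.map (toUnr p))).map (algebraMap (UnrSeries p) (S' m))) ^ m) :
    (XAc.charIdeal E p κ 𝔭 S γ).map (PowerSeries.map (toUnr p)) ≤ Ideal.span {LS} := by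
  haveI : Module.Finite (IwasawaAlgebra p) (XAc E p κ 𝔭 S γ) := XAc.module_finite κ 𝔭 S γ hS
  haveI := HidaLimitAlgebra.isNoetherianRing_unrSeries (p := p)
  have hI : (Ideal.span {(PowerSeries.C (p : ℤ_[p]) : IwasawaAlgebra p)}).map
      (PowerSeries.map (toUnr p)) ≤ (⊥ : Ideal (UnrSeries p)).jacobson := by
    rw [HidaLimitAlgebra.map_span_C_p]
    exact HidaLimitAlgebra.span_C_p_le_jacobson_unrSeries
  have hFC := CongruenceLimit.fittingIdeal_zero_eq_charIdeal_of_forall_length p (XAc E p κ 𝔭 S γ)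
    hT hnf
  have key := CongruenceDescent.map_le_span_of_oneSided_congruences_descent
    (PowerSeries.map (toUnr p)) (Ideal.span {(PowerSeries.C (p : ℤ_[p]) : IwasawaAlgebra p)}) hI
    (le_refl (Module.fittingIdeal (IwasawaAlgebra p) (XAc E p κ 𝔭 S γ) 0)) LS R' S' φ' hφ' N Lm e hF
    hc
  change (Module.charIdeal (IwasawaAlgebra p) (XAc E p κ 𝔭 S γ)).map (PowerSeries.map (toUnr p)) ≤ _
  rw [← hFC]
  exact key

end XAc

end Summit.BirchSwinnertonDyer.Rank1Residual.X11b

end
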